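import Summits.HodgeConjecture.HodgeConjecture.Theorems.MarkmanPartnerTransportPicardThreeK3SquaresTranscendentalPresentation
import Literature.AlgebraicGeometry.Motives.WeilTypePolarization

/-!
# Route MarkmanPartnerTransport · crux `PicardThreeK3Squares` (stmt-HodgeConjecture-19652) —
# a rational type-preserving endomorphism of `H²(S(ℂ); ℂ)` DESCENDS to a morphism of the Hodge
# structure `H²_B(S)`, and a self-similitude of `T(S)` gives a SECOND presentation of the transcendental part

Programme «KS-SELF», step 2b (Hodge side). For a smooth projective surface `S` (real Hodge model)
and a `ℂ`-linear `ψ : H²(S(ℂ); ℂ) → H²(S(ℂ); ℂ)` mapping rational classes to rational classes and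
preserving Hodge types:

* `exists_ratLinear_ofRatClass_eq` — `ψ` DESCENDS to `ℚ`: a `ℚ`-linear `Ψ` on `H²(S(ℂ); ℚ)` with
  `Ψ v ⊗ 1 = ψ(v ⊗ 1)`;
* `exists_hom_ofRatClass_eq` — **`Ψ` is a morphism of Hodge structures `H²_B(S) → H²_B(S)`** (the
  filtration `F^p = ⊕_{a ≥ p} Θ⁻¹ H^{a, 2-a}` is preserved since `ψ` preserves types);
* `exists_hom_transcendental` — if moreover `ψ(H²) ⊥ N¹(S)`, `Ψ` restricts to a Hodge endomorphism
  `ψ_T` of the sub-Hodge structure `T(S)_ℚ = Hdg¹(S)^⊥` (`y ⊥ N¹(S) ⟺ y ∈ T(S)_ℚ ⊗ ℂ`);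
* `hom_transcendental_sq`, `cupPairingBetti_hom_transcendental` — `ψ_T² = d` and `ψ_T` is
  `∫`-self-adjoint when `ψ² = d` on `T(S)` and `ψ` is cup-self-adjoint;
* `isTranscendentalPartBetti_smul_comp` — **THE SECOND PRESENTATION**: if `(T, P, ε, j)` presents the
  transcendental part (`IsTranscendentalPartBetti`) and `ψ_T` is a `P`-self-adjoint endomorphism of `T`
  with `ψ_T² = d`, `d > 0`, then `(T, d·P, ε, j ∘ ψ_T)` presents it too (`j ψ_T` is injective onto
  `T(S)_ℚ`, and `ε ∫ jψ_T t ∪ jψ_T t' = ε ∫ j t ∪ j ψ_T² t' = d · P(t, t')`).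

Sequel: the Kuga–Satake predicate of `S`, instantiated at the two presentations `(T, P, ε, j)` and
`(T, d·P, ε, j ∘ ψ_T)` with `φ`-transported auxiliary data (file `…KugaSatakeSimilarTransport`), yields
two algebraic correspondences `O₁`, `O₂ : H²(S) → H²(A × A)` with `O₂ ∘ ψ = O₁` on `T(S)`. THEOREMS
ONLY (existence statements; no definition, no named fact, no sorry); credits nothing to the Hodge
conjecture. Prover seat hodge-nonav-19652-p1 (gen 14), `--supports stmt-HodgeConjecture-19652`.

References: C. Voisin, *Hodge Theory and Complex Algebraic Geometry I* (2002), §7.1.1, §7.3.1, §11.3;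
B. van Geemen, *Kuga-Satake varieties and the Hodge conjecture* (2000), §10.1–10.2; M. Varesco,
Math. Z. 305 (2023), §4 (proof of Thm. 4.5: the two Kuga–Satake correspondences of a similitude).
-/

set_option linter.dupNamespace false

noncomputable section

namespace Summit.HodgeConjecture.HodgeConjecture.Theorems.MarkmanPartnerTransport.KugaSatakeSelf

open scoped TensorProduct
open CategoryTheory Literature.AlgebraicGeometry Literature.AlgebraicGeometry.Motives
open Literature.AlgebraicGeometry.HodgeTheory Literature.AlgebraicTopology.SingularHomology
open Literature.AlgebraicGeometry.Motives.HodgeStructure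
open Summit.HodgeConjecture.HodgeConjecture.Theorems.OddPrimeSquares
open Summit.HodgeConjecture.HodgeConjecture.Theorems.MarkmanPartnerTransport.TranscendentalPresentation

variable {S : SchemeOver ℂ}

/-- `H²_B(S)`: the weight-two `ℚ`-Hodge structure on `H²(S(ℂ); ℚ)` of the real Hodge model of `S`. -/
local notation3 "H²[" hS "]" =>
  bettiTwoHodgeStructure hS (BettiUniverse.realHodgeModel exists_isReal_hodgeModel_holds hS)
    (BettiUniverse.realHodgeModel_isHodgeSymmetric exists_isReal_hodgeModel_holds hS)

/-- `T(S)_ℚ = Hdg¹^⊥ ⊆ H²(S(ℂ); ℚ)`. -/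
local notation3 "T[" hS "]" =>
  transcendentalLatticeBetti hS (BettiUniverse.realHodgeModel exists_isReal_hodgeModel_holds hS)
    (BettiUniverse.realHodgeModel_isHodgeSymmetric exists_isReal_hodgeModel_holds hS)

/-- `Θ : ℂ ⊗_ℚ H²(S(ℂ); ℚ) → H²(S(ℂ); ℂ)`. -/
local notation3 "Θ[" S "]" => ofRatClassBaseChange (Motives.ComplexPoints S) (2 * 1)

/-- `ι : H²(S(ℂ); ℚ) → H²(S(ℂ); ℂ)`, the rational lattice. -/
local notation3 "ι[" S "]" => ofRatClass (Motives.ComplexPoints S) (2 * 1)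

/-- `Transc[S, y]`: `y` is cup-orthogonal to `N¹(S) = algebraicClasses S 1`. Local notation only. -/
local notation3 (prettyPrint := false) "Transc[" S ", " y "]" =>
  (∀ d ∈ algebraicClasses S 1, cupProduct (rfl : 2 * 1 + 2 * 1 = 2 * 2) y d = 0)

/-! ### §1 Rational descent of a rational `ℂ`-linear endomorphism -/

/-- **A `ℂ`-linear endomorphism of `H²(S(ℂ); ℂ)` mapping rational classes to rational classes is the
complexification of a unique `ℚ`-linear endomorphism `Ψ` of `H²(S(ℂ); ℚ)`**: `Ψ v ⊗ 1 = ψ(v ⊗ 1)`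
(the rational lattice `ι : H²(–; ℚ) → H²(–; ℂ)` is injective). [cite: VoisinHodgeI2002, §7.1.1 and §11.3.1] -/
theorem exists_ratLinear_ofRatClass_eq (ψ : complexBetti S (2 * 1) →ₗ[ℂ] complexBetti S (2 * 1))
    (h1 : ∀ y, IsRationalClass y → IsRationalClass (ψ y)) :
    ∃ Ψ : bettiCohomology S (2 * 1) →ₗ[ℚ] bettiCohomology S (2 * 1), ∀ v, ι[S] (Ψ v) = ψ (ι[S] v) := by
  have hex : ∀ v : bettiCohomology S (2 * 1), ∃ w : bettiCohomology S (2 * 1), ι[S] w = ψ (ι[S] v) :=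
    fun v => (isRationalClass_iff_mem_range_ofRatClass _).1 (h1 _ (isRationalClass_ofRatClass _))
  choose f hf using hex
  have hinj := ofRatClass_injective (Y := Motives.ComplexPoints S) (2 * 1)
  refine ⟨{ toFun := f, map_add' := fun v w => hinj ?_, map_smul' := fun q v => hinj ?_ }, hf⟩
  · rw [map_add, hf, hf, hf, map_add, map_add]
  · rw [hf, ofRatClass_smul, ofRatClass_smul, map_smul, hf, RingHom.id_apply]

/-- The complexification of the descent is `ψ`: `Θ (Ψ ⊗ ℂ) x = ψ (Θ x)`. [folklore] -/
theorem ofRatClassBaseChange_baseChange_eq {ψ : complexBetti S (2 * 1) →ₗ[ℂ] complexBetti S (2 * 1)}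
    {Ψ : bettiCohomology S (2 * 1) →ₗ[ℚ] bettiCohomology S (2 * 1)} (hΨ : ∀ v, ι[S] (Ψ v) = ψ (ι[S] v))
    (x : ℂ ⊗[ℚ] bettiCohomology S (2 * 1)) :
    Θ[S] (Ψ.baseChange ℂ x) = ψ (Θ[S] x) := by
  induction x using TensorProduct.induction_on with
  | zero => rw [map_zero, map_zero, map_zero]
  | tmul c v => rw [LinearMap.baseChange_tmul, ofRatClassBaseChange_tmul, ofRatClassBaseChange_tmul, hΨ, map_smul]
  | add x y hx hy => rw [map_add, map_add, map_add, map_add, hx, hy]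

/-! ### §2 The descent is a morphism of Hodge structures -/

/-- **A rational, Hodge-type-preserving endomorphism of `H²(S(ℂ); ℂ)` descends to a morphism of Hodge
structures `H²_B(S) → H²_B(S)`**: the Hodge filtration `F^p = ⊕_{a ≥ p} Θ⁻¹H^{a,2-a}`
(`HodgeModel.ratF_eq_iSup`) is preserved because `ψ` preserves each type `(a, 2-a)` (types read in the
real model by `hodgePQ_independent_of_hodgeModel_holds`). [cite: VoisinHodgeI2002, §7.3.1 and §7.1.1] -/
theorem exists_hom_ofRatClass_eq (hS : IsSmoothProjective 2 S)
    (ψ : complexBetti S (2 * 1) →ₗ[ℂ] complexBetti S (2 * 1))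
    (h1 : ∀ y, IsRationalClass y → IsRationalClass (ψ y))
    (h2 : ∀ (i j : ℕ) y, IsOfHodgeType 2 S (2 * 1) i j y → IsOfHodgeType 2 S (2 * 1) i j (ψ y)) :
    ∃ Ψ : Hom (H²[hS]) (H²[hS]), ∀ v, ι[S] (Ψ.toLinearMap v) = ψ (ι[S] v) := by
  obtain ⟨Ψ, hΨ⟩ := exists_ratLinear_ofRatClass_eq ψ h1
  set A := BettiUniverse.realHodgeModel exists_isReal_hodgeModel_holds hS with hA
  have hI := hodgePQ_independent_of_hodgeModel_holds
  refine ⟨{ toLinearMap := Ψ, map_F_le := fun r => ?_ }, hΨ⟩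
  rintro _ ⟨x, hx, rfl⟩
  have hF : (H²[hS]).F r = A.ratF hS (2 * 1) r := rfl
  rw [SetLike.mem_coe, hF, HodgeModel.ratF_eq_iSup] at hx
  rw [hF, HodgeModel.ratF_eq_iSup]
  induction hx using Submodule.iSup_induction' with
  | mem pq x hx =>
    by_cases hr : r ≤ (pq.1.1 : ℤ)
    · rw [iSup_pos hr, HodgeModel.mem_ratPiece_iff, HodgeModel.complexification_apply] at hx
      have hty : IsOfHodgeType 2 S (2 * 1) pq.1.1 pq.1.2 (Θ[S] x) := ⟨A, hx⟩
      have hty' := h2 _ _ _ hty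
      rw [← ofRatClassBaseChange_baseChange_eq hΨ] at hty'
      obtain ⟨B', hB'⟩ := hty'
      have h3 := hI 2 S hS B' A (2 * 1) pq.1.1 pq.1.2 _ hB'
      refine Submodule.mem_iSup_of_mem pq (Submodule.mem_iSup_of_mem hr ?_)
      rw [HodgeModel.mem_ratPiece_iff, HodgeModel.complexification_apply]
      exact h3
    · rw [iSup_neg hr, Submodule.mem_bot] at hx
      rw [hx, map_zero]
      exact Submodule.zero_mem _
  | zero => rw [map_zero]; exact Submodule.zero_mem _
  | add x y _ _ hx hy => rw [map_add]; exact Submodule.add_mem _ hx hy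

/-! ### §3 Restriction to the transcendental lattice -/

/-- `Θ((Hdg¹)_ℂ) = N¹(S)`: a Hodge class of `H²_B(S)` complexifies to an algebraic (divisor) class.
[cite: VoisinHodgeI2002, Thm. 11.30] -/
theorem ofRatClass_mem_algebraicClasses_of_mem_hodgeClasses (hS : IsSmoothProjective 2 S)
    {n : bettiCohomology S (2 * 1)} (hn : n ∈ (H²[hS]).hodgeClasses 1) : ι[S] n ∈ algebraicClasses S 1 := by
  rw [← map_hodgeClasses_baseChange_eq_algebraicClasses hS]
  exact ⟨(1 : ℂ) ⊗ₜ n, Submodule.tmul_mem_baseChange_of_mem 1 hn, by rw [ofRatClassBaseChange_tmul, one_smul]⟩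

/-- **`T(S)_ℚ = {t | t ⊗ 1 ⊥ N¹(S)}`**: a rational class lies in the transcendental lattice `Hdg¹(S)^⊥`
iff its complexification is cup-orthogonal to the algebraic divisor classes (`N¹(S)` is spanned by the
complexified Hodge classes, `map_hodgeClasses_baseChange_eq_algebraicClasses`). [cite: Huybrechts2016K3, Ch. 3 Lemma 3.1] -/
theorem mem_transcendental_iff_transc (hS : IsSmoothProjective 2 S) (t : bettiCohomology S (2 * 1)) :
    t ∈ T[hS] ↔ Transc[S, ι[S] t] := by
  have hinj := ofRatClass_injective (Y := Motives.ComplexPoints S) (2 * 2)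
  constructor
  · intro ht c hc
    rw [← map_hodgeClasses_baseChange_eq_algebraicClasses hS] at hc
    obtain ⟨u, hu, rfl⟩ := hc
    obtain ⟨u', rfl⟩ := hu
    induction u' using TensorProduct.induction_on with
    | zero => rw [map_zero, map_zero, map_zero]
    | tmul a n =>
      rw [LinearMap.baseChange_tmul, Submodule.subtype_apply, ofRatClassBaseChange_tmul, map_smul]
      have h0 : cupPairingBetti hS t n = 0 := by
        rw [(cupPairingBetti_isSymm hS).eq]
        exact (mem_transcendentalLatticeBetti_iff hS _ _ t).1 ht _ n.2
      rw [cupPairingBetti_apply] at h0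
      have h1 := congrArg (ofRatClass (Motives.ComplexPoints S) (2 * 2)) (eq_zero_of_trace_eq_zero hS h0)
      rw [map_zero, ofRatClass_eq_ringChange, singularCohomology.ringChange_cupProduct,
        ← ofRatClass_eq_ringChange, ← ofRatClass_eq_ringChange] at h1
      rw [h1, smul_zero]
    | add x y hx hy => rw [map_add, map_add, map_add, hx, hy, add_zero]
  · intro ht
    rw [mem_transcendentalLatticeBetti_iff]
    intro n hn
    rw [(cupPairingBetti_isSymm hS).eq, cupPairingBetti_apply]
    have h0 := ht _ (ofRatClass_mem_algebraicClasses_of_mem_hodgeClasses hS hn)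
    rw [ofRatClass_eq_ringChange, ofRatClass_eq_ringChange, ← singularCohomology.ringChange_cupProduct,
      ← ofRatClass_eq_ringChange] at h0
    have h1 : cupProduct (X := Motives.ComplexPoints S) (R := ℚ) (rfl : 2 * 1 + 2 * 1 = 2 * 2) t n = 0 :=
      hinj (by rw [h0, map_zero])
    rw [h1, map_zero]

/-- **A Hodge endomorphism of `T(S)_ℚ` from `ψ`.** For a sub-Hodge structure `T` of `H²_B(S)` with
underlying space `T(S)_ℚ` and `ψ` rational, type-preserving with image cup-orthogonal to `N¹(S)`, the
descent `Ψ` maps `T(S)_ℚ` into itself and restricts to `ψ_T : Hom T T` with `(ψ_T t) ⊗ 1 = ψ(t ⊗ 1)`.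
[cite: VoisinHodgeI2002, §7.3.1] [cite: Huybrechts2016K3, Ch. 3 Lemma 3.1] -/
theorem exists_hom_transcendental (hS : IsSmoothProjective 2 S) (T : SubHodgeStructure (H²[hS]))
    (hT : T.toSubmodule = T[hS]) (ψ : complexBetti S (2 * 1) →ₗ[ℂ] complexBetti S (2 * 1))
    (h1 : ∀ y, IsRationalClass y → IsRationalClass (ψ y))
    (h2 : ∀ (i j : ℕ) y, IsOfHodgeType 2 S (2 * 1) i j y → IsOfHodgeType 2 S (2 * 1) i j (ψ y))
    (h4 : ∀ y : complexBetti S (2 * 1), Transc[S, ψ y]) :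
    ∃ ψT : Hom T.toHodgeStructure T.toHodgeStructure,
      ∀ t : T.toSubmodule, ι[S] ((ψT.toLinearMap t : T.toSubmodule) : bettiCohomology S (2 * 1)) =
        ψ (ι[S] (t : bettiCohomology S (2 * 1))) := by
  obtain ⟨Ψ, hΨ⟩ := exists_hom_ofRatClass_eq hS ψ h1 h2
  have hmem : ∀ t : T.toSubmodule, (Ψ.comp T.subtypeHom).toLinearMap t ∈ T.toSubmodule := by
    intro t
    have h : Ψ.toLinearMap (t : bettiCohomology S (2 * 1)) ∈ T[hS] := by
      rw [mem_transcendental_iff_transc hS, hΨ]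
      exact h4 _
    exact (le_of_eq hT.symm : T[hS] ≤ T.toSubmodule) h
  exact ⟨(Ψ.comp T.subtypeHom).codRestrict T hmem, fun t => hΨ _⟩

/-! ### §4 Square and self-adjointness of the restriction -/

section Restriction

variable {hS : IsSmoothProjective 2 S} {T : SubHodgeStructure (H²[hS])}
  {ψ : complexBetti S (2 * 1) →ₗ[ℂ] complexBetti S (2 * 1)}
  {ψT : Hom T.toHodgeStructure T.toHodgeStructure}

/-- **`ψ_T² = d`** when `ψ² = d` on `T(S)`. [folklore] -/
theorem hom_transcendental_sq (hT : T.toSubmodule = T[hS])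
    (hψT : ∀ t : T.toSubmodule, ι[S] ((ψT.toLinearMap t : T.toSubmodule) : bettiCohomology S (2 * 1)) =
      ψ (ι[S] (t : bettiCohomology S (2 * 1))))
    {d : ℚ} (hψψ : ∀ y : complexBetti S (2 * 1), Transc[S, y] → ψ (ψ y) = (d : ℂ) • y) (t : T.toSubmodule) :
    ψT.toLinearMap (ψT.toLinearMap t) = d • t := by
  apply Subtype.ext
  apply ofRatClass_injective (Y := Motives.ComplexPoints S) (2 * 1)
  have ht : Transc[S, ι[S] (t : bettiCohomology S (2 * 1))] :=
    (mem_transcendental_iff_transc hS _).1 (hT ▸ t.2)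
  rw [hψT, hψT, hψψ _ ht, Submodule.coe_smul, ofRatClass_smul]

/-- **`ψ_T` is `∫`-self-adjoint** when `ψ` is cup-self-adjoint: `∫ ψ_T a ∪ b = ∫ a ∪ ψ_T b`. [folklore] -/
theorem cupPairingBetti_hom_transcendental
    (hψT : ∀ t : T.toSubmodule, ι[S] ((ψT.toLinearMap t : T.toSubmodule) : bettiCohomology S (2 * 1)) =
      ψ (ι[S] (t : bettiCohomology S (2 * 1))))
    (h5 : ∀ y w : complexBetti S (2 * 1),
      cupProduct (rfl : 2 * 1 + 2 * 1 = 2 * 2) (ψ y) w = cupProduct (rfl : 2 * 1 + 2 * 1 = 2 * 2) y (ψ w))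
    (a b : T.toSubmodule) :
    cupPairingBetti hS (ψT.toLinearMap a : bettiCohomology S (2 * 1)) b =
      cupPairingBetti hS (a : bettiCohomology S (2 * 1)) (ψT.toLinearMap b) := by
  rw [cupPairingBetti_apply, cupPairingBetti_apply]
  congr 1
  apply ofRatClass_injective (Y := Motives.ComplexPoints S) (2 * 2)
  rw [ofRatClass_eq_ringChange, singularCohomology.ringChange_cupProduct, ← ofRatClass_eq_ringChange,
    ← ofRatClass_eq_ringChange, hψT, h5, ← hψT, ofRatClass_eq_ringChange, ofRatClass_eq_ringChange,
    ← singularCohomology.ringChange_cupProduct, ← ofRatClass_eq_ringChange]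

end Restriction

/-! ### §5 The second presentation `(T, d·P, ε, j ∘ ψ_T)` -/

/-- **The second presentation of the transcendental part.** Let `(T, H, P, ε, j)` present the
transcendental part of `S` (`IsTranscendentalPartBetti`: `j` injective onto `T(S)_ℚ`, `P = ε ∫ (j·) ∪ (j·)`)
and let `g : Hom H H` be `P`-self-adjoint (through `j` and `∫`) with `g² = d`, `d > 0`. Then
`(T, H, d·P, ε, j ∘ g)` presents the transcendental part as well: `j g` is injective (`g² = d ≠ 0`), onto
`T(S)_ℚ` (`t = g(d⁻¹ g t)`), and `ε ∫ jg t ∪ jg t' = ε ∫ j t ∪ j g² t' = d · P(t, t')`. This is the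
presentation at which the Kuga–Satake predicate is instantiated a second time (Varesco's "`ψ` induces a
similitude of multiplier `λ`", read as a change of presentation). [cite: Varesco2023, §4 (proof of Thm. 4.5)]
[cite: vanGeemen2000KugaSatakeHC, §10.1–10.2] -/
theorem isTranscendentalPartBetti_smul_comp (hS : IsSmoothProjective 2 S)
    {M : HodgeModel 2 S} {hM : M.IsHodgeSymmetric}
    {T : Type} [AddCommGroup T] [Module ℚ T] {H : HodgeStructure T 2} {P : H.Polarization} {ε : ℤˣ}
    {j : H.Hom (bettiTwoHodgeStructure hS M hM)} (hj : IsTranscendentalPartBetti hS M hM H P ε j)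
    (g : Hom H H) {d : ℚ} (hd : 0 < d) (hgg : ∀ t, g.toLinearMap (g.toLinearMap t) = d • t)
    (hga : ∀ a b, cupPairingBetti hS (j.toLinearMap (g.toLinearMap a)) (j.toLinearMap b) =
      cupPairingBetti hS (j.toLinearMap a) (j.toLinearMap (g.toLinearMap b))) :
    IsTranscendentalPartBetti hS M hM H (P.smul d hd) ε (j.comp g) := by
  obtain ⟨hinj, hrange, hform⟩ := hj
  have hd0 : d ≠ 0 := hd.ne'
  have hginj : Function.Injective g.toLinearMap := by
    intro a b h
    have h' := congrArg g.toLinearMap h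
    rw [hgg, hgg] at h'
    exact smul_right_injective T hd0 h'
  refine ⟨hinj.comp hginj, ?_, ?_⟩
  · rw [← hrange]
    refine le_antisymm ?_ ?_
    · rintro _ ⟨t, rfl⟩
      exact ⟨g.toLinearMap t, rfl⟩
    · rintro _ ⟨t, rfl⟩
      refine ⟨d⁻¹ • g.toLinearMap t, ?_⟩
      change j.toLinearMap (g.toLinearMap (d⁻¹ • g.toLinearMap t)) = j.toLinearMap t
      rw [map_smul, hgg, smul_smul, inv_mul_cancel₀ hd0, one_smul]
  · refine LinearMap.ext fun t => LinearMap.ext fun t' => ?_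
    change d * P.form t t' = _
    rw [hform]
    simp only [LinearMap.smul_apply, LinearMap.compl₁₂_apply, smul_eq_mul]
    change _ = ((ε : ℤ) : ℚ) * cupPairingBetti hS (j.toLinearMap (g.toLinearMap t)) (j.toLinearMap (g.toLinearMap t'))
    rw [hga, hgg, map_smul, map_smul, smul_eq_mul]
    ring

end Summit.HodgeConjecture.HodgeConjecture.Theorems.MarkmanPartnerTransport.KugaSatakeSelf

end
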